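import Summits.CriticalPhenomena.PercolationContinuityZ3.Theorems.PercNearOneGluingNoHeavyLowerTailThetaWired
import Summits.CriticalPhenomena.PercolationContinuityZ3.Theorems.PercNearOneGluingNoHeavyLowerTailApexTwoSum
import HarnessLib

/-!
# `NoHeavyLowerTail` (stmt-CriticalPhenomena-4575) — the 1|1|1 hub pair (Θ-graphs), part 2:
# the far-side rows `W⁰, W¹, CROSS` and the wired R1 for two terminal arms in parallel, from R1 + FKG on the arms

Support file (prover prim-gen-kcluster gen 72; `--supports stmt-CriticalPhenomena-4575`).  No definitions, no named facts, no sorries.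
SETTING of part 1 (`…ThetaWired`): terminal arms `DB ∋ b`, `DC ∋ c` meeting only in `h₁ ≠ h₂`; `φ_B = rcMeasureW wB q ∅`, `φ_C`, the far side
`φ = rcMeasureW w q ∅` (`w` on `DB ∪ DC`) and its `{h₁,h₂}`-wired version `φ_w = rcMeasureW w q {h₁,h₂}`.
ARM HYPOTHESES (for `B`, and the same for `C`): R1 for `(h₁; b, h₂)` (`ρ_B ≥ 0`), R1 for `(h₂; b, h₁)` (`σ_B ≥ 0`), the FKG slack for `(h₁; b, h₂)`
(`φ_B ≥ 0`; automatic for `q ≥ 1`), and non-degeneracy `φ_B(b, h₂ ∈ C(h₁)) ≠ 0`.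
* `ThetaFar.armB_slacks`, `armC_slacks` — the arm rows as inequalities of `{h₁,h₂}`-wired arm masses (`ρ, σ, φ ≥ 0`, `X_A > 0`), the apex-`h₂`
  cells rewritten into apex-`h₁` cells by part 1's symmetries;
* `ThetaFar.wired_row` — R1 for `φ_w` on the wired cells (in fact equality: the wired cells are products, part 1);
* `ThetaFar.cross_row` — gen 57's CROSS `X[φ@h₁, φ@h₂] ≥ 0` for the far side `DB ∪ DC` (dictionary `…ApexTwoSumSums` at both apices +
  `ThetaBlocks.CROSS_cert`, p367913);
* `ThetaFar.w0_row`, `w1_row` — gen 65's free–wired rows `X[φ_w, φ@h₁] ≥ 0`, `X[φ_w, φ@h₂] ≥ 0` (`ThetaBlocks.W0_cert`, `W1_cert`).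
These are exactly the six hypotheses of `HubPairApex.r1_of_far_side` for the far side `DB ∪ DC` (with `ApexTwoSum.r1_of_apexTwoSum` at the two
hubs); part 3 (`…ThetaR1`) concludes R1 on every Θ-graph `A_a ∪ A_b ∪ A_c` (KCLUSTER-gen65 Corollary A, now kernel at the measure level).
-/

noncomputable section

namespace Summit.CriticalPhenomena.PercolationContinuityZ3.Theorems

namespace ThetaFar

open Finset SimpleGraph Literature.Probability.Percolation Literature.Probability.Percolation.Gladkov
open Literature.Probability.Percolation.BHK2006 (weight)
open Literature.Probability.Percolation.DecisionTree (ind ind_of_mem ind_of_not_mem ind_nonneg)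
open Literature.Probability.LatticeModels RefinedRowR3 ThreePointLB APL MeasureTheory
open scoped Classical

variable {V : Type*} [Fintype V]

omit [Fintype V] in
/-- From masses to the measure: one partition function. [folklore] -/
theorem sq_le_div {Z x y u v : ℝ} (hZ : 0 < Z) (h : x * y ≤ u * v) : x / Z * (y / Z) ≤ u / Z * (v / Z) := by
  rw [div_mul_div_comm, div_mul_div_comm]
  exact div_le_div_of_nonneg_right h (mul_pos hZ hZ).le

omit [Fintype V] in
/-- From masses to the measure: two partition functions (polar rows). [folklore] -/
theorem polar_le_div {Z₁ Z₂ x y x' y' u v u' v' : ℝ} (h1 : 0 < Z₁) (h2 : 0 < Z₂) (h : x * y + x' * y' ≤ u * v + u' * v') :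
    x / Z₁ * (y / Z₂) + x' / Z₂ * (y' / Z₁) ≤ u / Z₁ * (v / Z₂) + u' / Z₂ * (v' / Z₁) := by
  rw [div_mul_div_comm, div_mul_div_comm, div_mul_div_comm, div_mul_div_comm, mul_comm Z₂ Z₁, ← add_div, ← add_div]
  exact div_le_div_of_nonneg_right h (mul_pos h1 h2).le

section Rows

variable {DB DC : Finset (Sym2 V)} {h₁ h₂ b c : V} (h12 : h₁ ≠ h₂) (h1b : h₁ ≠ b) (h1c : h₁ ≠ c) (hbc : b ≠ c) (h2b : h₂ ≠ b) (h2c : h₂ ≠ c)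
  (hsep : ∀ z : V, (∃ e ∈ DB, z ∈ e) → (∃ e ∈ DC, z ∈ e) → (z = h₁ ∨ z = h₂))
  (hbC : ∀ e ∈ DC, b ∉ e) (hcB : ∀ e ∈ DB, c ∉ e)
  (w wB wC : Sym2 V → unitInterval) {q : ℝ} (hq : 0 < q) (hw : ∀ e, e ∉ (↑DB ∪ ↑DC : Set (Sym2 V)) → (w e : ℝ) = 0)
  (hX : ∀ e ∈ (↑DB : Set (Sym2 V)), wB e = w e) (hX' : ∀ e ∉ (↑DB : Set (Sym2 V)), wB e = 0)
  (hY : ∀ e ∈ (↑DB : Set (Sym2 V)), wC e = 0) (hY' : ∀ e ∉ (↑DB : Set (Sym2 V)), wC e = w e)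

include h12 hq in
/-- **Arm `B`: the rows as inequalities of wired masses** (`ρ_B, σ_B, φ_B ≥ 0`, `X_A > 0`). [this work] -/
theorem armB_slacks (hR1B : (rcMeasureW wB q ∅).real {η : BondConfig V | b ∈ cl η.toFinset h₁ ∧ h₂ ∈ cl η.toFinset h₁} * (rcMeasureW wB q ∅).real {η : BondConfig V | b ∉ cl η.toFinset h₁ ∧ h₂ ∉ cl η.toFinset h₁ ∧ Sep DB (cl η.toFinset h₁) b h₂} ≤ (rcMeasureW wB q ∅).real {η : BondConfig V | b ∈ cl η.toFinset h₁ ∧ h₂ ∉ cl η.toFinset h₁} * (rcMeasureW wB q ∅).real {η : BondConfig V | b ∉ cl η.toFinset h₁ ∧ h₂ ∈ cl η.toFinset h₁}) (hR2B : (rcMeasureW wB q ∅).real {η : BondConfig V | b ∈ cl η.toFinset h₂ ∧ h₁ ∈ cl η.toFinset h₂} * (rcMeasureW wB q ∅).real {η : BondConfig V | b ∉ cl η.toFinset h₂ ∧ h₁ ∉ cl η.toFinset h₂ ∧ Sep DB (cl η.toFinset h₂) b h₁} ≤ (rcMeasureW wB q ∅).real {η : BondConfig V | b ∈ cl η.toFinset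 h₂ ∧ h₁ ∉ cl η.toFinset h₂} * (rcMeasureW wB q ∅).real {η : BondConfig V | b ∉ cl η.toFinset h₂ ∧ h₁ ∈ cl η.toFinset h₂})
    (hFB : (rcMeasureW wB q ∅).real {η : BondConfig V | b ∉ cl η.toFinset h₁ ∧ h₂ ∈ cl η.toFinset h₁} * ((rcMeasureW wB q ∅).real {η : BondConfig V | b ∈ cl η.toFinset h₁ ∧ h₂ ∉ cl η.toFinset h₁} + (rcMeasureW wB q ∅).real {η : BondConfig V | b ∉ cl η.toFinset h₁ ∧ h₂ ∉ cl η.toFinset h₁ ∧ h₂ ∈ cl η.toFinset b}) ≤ (rcMeasureW wB q ∅).real {η : BondConfig V | b ∈ cl η.toFinset h₁ ∧ h₂ ∈ cl η.toFinset h₁} * (rcMeasureW wB q ∅).real {η : BondConfig V | b ∉ cl η.toFinset h₁ ∧ h₂ ∉ cl η.toFinset h₁ ∧ h₂ ∉ cl η.toFinset b}) (hAB : (rcMeasureW wB q ∅).real {η : BondConfig V | b ∈ cl η.toFinset h₁ ∧ h₂ ∈ cl η.toFinset h₁} ≠ 0) :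
    0 ≤ (∑ η : BondConfig V, rcWeightW wB q ({h₁, h₂} : Set V) η * ind {η : BondConfig V | b ∈ cl η.toFinset h₁ ∧ h₂ ∈ cl η.toFinset h₁} η) * (q * (∑ η : BondConfig V, rcWeightW wB q ({h₁, h₂} : Set V) η * ind {η : BondConfig V | b ∉ cl η.toFinset h₁ ∧ h₂ ∉ cl η.toFinset h₁ ∧ h₂ ∉ cl η.toFinset b} η)) - (∑ η : BondConfig V, rcWeightW wB q ({h₁, h₂} : Set V) η * ind {η : BondConfig V | b ∉ cl η.toFinset h₁ ∧ h₂ ∈ cl η.toFinset h₁} η) * (q * (∑ η : BondConfig V, rcWeightW wB q ({h₁, h₂} : Set V) η * ind {η : BondConfig V | b ∈ cl η.toFinset h₁ ∧ h₂ ∉ cl η.toFinset h₁} η) + q * (∑ η : BondConfig V, rcWeightW wB q ({h₁, h₂} : Set V) η * ind {η : BondConfig V | b ∉ cl η.toFinset h₁ ∧ h₂ ∉ cl η.toFinset h₁ ∧ h₂ ∈ cl η.toFinset b} η)) ∧ 0 ≤ (∑ η : BondConfig V, rcWeightW wB q ({h₁, h₂} : Set V) η * ind {η : BondConfig V | b ∉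 cl η.toFinset h₁ ∧ h₂ ∈ cl η.toFinset h₁} η) * (q * (∑ η : BondConfig V, rcWeightW wB q ({h₁, h₂} : Set V) η * ind {η : BondConfig V | b ∈ cl η.toFinset h₁ ∧ h₂ ∉ cl η.toFinset h₁} η)) - (∑ η : BondConfig V, rcWeightW wB q ({h₁, h₂} : Set V) η * ind {η : BondConfig V | b ∈ cl η.toFinset h₁ ∧ h₂ ∈ cl η.toFinset h₁} η) * (q * (∑ η : BondConfig V, rcWeightW wB q ({h₁, h₂} : Set V) η * ind {η : BondConfig V | b ∉ cl η.toFinset h₁ ∧ h₂ ∉ cl η.toFinset h₁ ∧ Sep DB (cl η.toFinset h₁) b h₂} η)) ∧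
      0 ≤ (∑ η : BondConfig V, rcWeightW wB q ({h₁, h₂} : Set V) η * ind {η : BondConfig V | b ∉ cl η.toFinset h₁ ∧ h₂ ∈ cl η.toFinset h₁} η) * (q * (∑ η : BondConfig V, rcWeightW wB q ({h₁, h₂} : Set V) η * ind {η : BondConfig V | b ∉ cl η.toFinset h₁ ∧ h₂ ∉ cl η.toFinset h₁ ∧ h₂ ∈ cl η.toFinset b} η)) - (∑ η : BondConfig V, rcWeightW wB q ({h₁, h₂} : Set V) η * ind {η : BondConfig V | b ∈ cl η.toFinset h₁ ∧ h₂ ∈ cl η.toFinset h₁} η) * (q * (∑ η : BondConfig V, rcWeightW wB q ({h₁, h₂} : Set V) η * ind {η : BondConfig V | b ∉ cl η.toFinset h₂ ∧ h₁ ∉ cl η.toFinset h₂ ∧ Sep DB (cl η.toFinset h₂) b h₁} η)) ∧ 0 < (∑ η : BondConfig V, rcWeightW wB q ({h₁, h₂} : Set V) η * ind {η : BondConfig V | b ∈ cl η.toFinset h₁ ∧ h₂ ∈ cl η.toFinset h₁} η) := by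
  have hZ := rcPartitionFunctionW_pos wB hq (∅ : Set V)
  have hZ2 : 0 < rcPartitionFunctionW wB q ∅ * rcPartitionFunctionW wB q ∅ := mul_pos hZ hZ
  have hnn : ∀ (E : Set (BondConfig V)), 0 ≤ ∑ η : BondConfig V, rcWeightW wB q ({h₁, h₂} : Set V) η * ind E η := fun E =>
    Finset.sum_nonneg fun η _ => mul_nonneg (rcWeightW_nonneg wB hq.le _ η) (ind_nonneg E η)
  simp only [rcMeasureW_real_eq_sum_div wB hq] at hR1B hR2B hFB hAB
  rw [ApexTwoSum.free_eq_wired h12 wB q (E := {η : BondConfig V | b ∈ cl η.toFinset h₁ ∧ h₂ ∈ cl η.toFinset h₁}) (fun η hη => hη.2), ApexTwoSum.free_eq_q_wired h12 wB q (E := {η : BondConfig V | b ∉ cl η.toFinset h₁ ∧ h₂ ∉ cl η.toFinset h₁ ∧ Sep DB (cl η.toFinset h₁) b h₂}) (fun η hη => hη.2.1),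
    ApexTwoSum.free_eq_q_wired h12 wB q (E := {η : BondConfig V | b ∈ cl η.toFinset h₁ ∧ h₂ ∉ cl η.toFinset h₁}) (fun η hη => hη.2), ApexTwoSum.free_eq_wired h12 wB q (E := {η : BondConfig V | b ∉ cl η.toFinset h₁ ∧ h₂ ∈ cl η.toFinset h₁}) (fun η hη => hη.2)] at hR1B
  rw [ApexTwoSum.free_eq_wired h12.symm wB q (E := {η : BondConfig V | b ∈ cl η.toFinset h₂ ∧ h₁ ∈ cl η.toFinset h₂}) (fun η hη => hη.2), ApexTwoSum.free_eq_q_wired h12.symm wB q (E := {η : BondConfig V | b ∉ cl η.toFinset h₂ ∧ h₁ ∉ cl η.toFinset h₂ ∧ Sep DB (cl η.toFinset h₂) b h₁}) (fun η hη => hη.2.1),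
    ApexTwoSum.free_eq_q_wired h12.symm wB q (E := {η : BondConfig V | b ∈ cl η.toFinset h₂ ∧ h₁ ∉ cl η.toFinset h₂}) (fun η hη => hη.2), ApexTwoSum.free_eq_wired h12.symm wB q (E := {η : BondConfig V | b ∉ cl η.toFinset h₂ ∧ h₁ ∈ cl η.toFinset h₂}) (fun η hη => hη.2)] at hR2B
  simp only [Set.pair_comm h₂ h₁, ← cellA_symm b h₁ h₂, ← cellB_symm b h₁ h₂, ← cellD_symm b h₁ h₂] at hR2B
  rw [ApexTwoSum.free_eq_wired h12 wB q (E := {η : BondConfig V | b ∉ cl η.toFinset h₁ ∧ h₂ ∈ cl η.toFinset h₁}) (fun η hη => hη.2), ApexTwoSum.free_eq_q_wired h12 wB q (E := {η : BondConfig V | b ∈ cl η.toFinset h₁ ∧ h₂ ∉ cl η.toFinset h₁}) (fun η hη => hη.2),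
    ApexTwoSum.free_eq_q_wired h12 wB q (E := {η : BondConfig V | b ∉ cl η.toFinset h₁ ∧ h₂ ∉ cl η.toFinset h₁ ∧ h₂ ∈ cl η.toFinset b}) (fun η hη => hη.2.1), ApexTwoSum.free_eq_wired h12 wB q (E := {η : BondConfig V | b ∈ cl η.toFinset h₁ ∧ h₂ ∈ cl η.toFinset h₁}) (fun η hη => hη.2),
    ApexTwoSum.free_eq_q_wired h12 wB q (E := {η : BondConfig V | b ∉ cl η.toFinset h₁ ∧ h₂ ∉ cl η.toFinset h₁ ∧ h₂ ∉ cl η.toFinset b}) (fun η hη => hη.2.1)] at hFB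
  rw [ApexTwoSum.free_eq_wired h12 wB q (E := {η : BondConfig V | b ∈ cl η.toFinset h₁ ∧ h₂ ∈ cl η.toFinset h₁}) (fun η hη => hη.2)] at hAB
  refine ⟨?_, ?_, ?_, lt_of_le_of_ne (hnn _) (fun h0 => hAB (by rw [← h0, zero_div]))⟩
  · rw [← add_div, div_mul_div_comm, div_mul_div_comm, div_le_div_iff_of_pos_right hZ2] at hFB
    linarith
  · rw [div_mul_div_comm, div_mul_div_comm, div_le_div_iff_of_pos_right hZ2] at hR1B
    linarith
  · rw [div_mul_div_comm, div_mul_div_comm, div_le_div_iff_of_pos_right hZ2] at hR2B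
    linarith

include h12 hq in
/-- **Arm `C`: the rows as inequalities of wired masses.** [this work] -/
theorem armC_slacks (hR1C : (rcMeasureW wC q ∅).real {η : BondConfig V | c ∈ cl η.toFinset h₁ ∧ h₂ ∈ cl η.toFinset h₁} * (rcMeasureW wC q ∅).real {η : BondConfig V | c ∉ cl η.toFinset h₁ ∧ h₂ ∉ cl η.toFinset h₁ ∧ Sep DC (cl η.toFinset h₁) c h₂} ≤ (rcMeasureW wC q ∅).real {η : BondConfig V | c ∈ cl η.toFinset h₁ ∧ h₂ ∉ cl η.toFinset h₁} * (rcMeasureW wC q ∅).real {η : BondConfig V | c ∉ cl η.toFinset h₁ ∧ h₂ ∈ cl η.toFinset h₁}) (hR2C : (rcMeasureW wC q ∅).real {η : BondConfig V | c ∈ cl η.toFinset h₂ ∧ h₁ ∈ cl η.toFinset h₂} * (rcMeasureW wC q ∅).real {η : BondConfig V | c ∉ cl η.toFinset h₂ ∧ h₁ ∉ cl η.toFinset h₂ ∧ Sep DC (cl η.toFinset h₂) c h₁} ≤ (rcMeasureW wC q ∅).real {η : BondConfig V | c ∈ cl η.toFinset h₂ ∧ h₁ ∉ cl η.toFinset h₂}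 * (rcMeasureW wC q ∅).real {η : BondConfig V | c ∉ cl η.toFinset h₂ ∧ h₁ ∈ cl η.toFinset h₂})
    (hFC : (rcMeasureW wC q ∅).real {η : BondConfig V | c ∉ cl η.toFinset h₁ ∧ h₂ ∈ cl η.toFinset h₁} * ((rcMeasureW wC q ∅).real {η : BondConfig V | c ∈ cl η.toFinset h₁ ∧ h₂ ∉ cl η.toFinset h₁} + (rcMeasureW wC q ∅).real {η : BondConfig V | c ∉ cl η.toFinset h₁ ∧ h₂ ∉ cl η.toFinset h₁ ∧ h₂ ∈ cl η.toFinset c}) ≤ (rcMeasureW wC q ∅).real {η : BondConfig V | c ∈ cl η.toFinset h₁ ∧ h₂ ∈ cl η.toFinset h₁} * (rcMeasureW wC q ∅).real {η : BondConfig V | c ∉ cl η.toFinset h₁ ∧ h₂ ∉ cl η.toFinset h₁ ∧ h₂ ∉ cl η.toFinset c}) (hAC : (rcMeasureW wC q ∅).real {η : BondConfig V | c ∈ cl η.toFinset h₁ ∧ h₂ ∈ cl η.toFinset h₁} ≠ 0) :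
    0 ≤ (∑ η : BondConfig V, rcWeightW wC q ({h₁, h₂} : Set V) η * ind {η : BondConfig V | c ∈ cl η.toFinset h₁ ∧ h₂ ∈ cl η.toFinset h₁} η) * (q * (∑ η : BondConfig V, rcWeightW wC q ({h₁, h₂} : Set V) η * ind {η : BondConfig V | c ∉ cl η.toFinset h₁ ∧ h₂ ∉ cl η.toFinset h₁ ∧ h₂ ∉ cl η.toFinset c} η)) - (∑ η : BondConfig V, rcWeightW wC q ({h₁, h₂} : Set V) η * ind {η : BondConfig V | c ∉ cl η.toFinset h₁ ∧ h₂ ∈ cl η.toFinset h₁} η) * (q * (∑ η : BondConfig V, rcWeightW wC q ({h₁, h₂} : Set V) η * ind {η : BondConfig V | c ∈ cl η.toFinset h₁ ∧ h₂ ∉ cl η.toFinset h₁} η) + q * (∑ η : BondConfig V, rcWeightW wC q ({h₁, h₂} : Set V) η * ind {η : BondConfig V | c ∉ cl η.toFinset h₁ ∧ h₂ ∉ cl η.toFinset h₁ ∧ h₂ ∈ cl η.toFinset c} η)) ∧ 0 ≤ (∑ η : BondConfig V, rcWeightW wC q ({h₁, h₂} : Set V) η * ind {η : BondConfig V | c ∉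 cl η.toFinset h₁ ∧ h₂ ∈ cl η.toFinset h₁} η) * (q * (∑ η : BondConfig V, rcWeightW wC q ({h₁, h₂} : Set V) η * ind {η : BondConfig V | c ∈ cl η.toFinset h₁ ∧ h₂ ∉ cl η.toFinset h₁} η)) - (∑ η : BondConfig V, rcWeightW wC q ({h₁, h₂} : Set V) η * ind {η : BondConfig V | c ∈ cl η.toFinset h₁ ∧ h₂ ∈ cl η.toFinset h₁} η) * (q * (∑ η : BondConfig V, rcWeightW wC q ({h₁, h₂} : Set V) η * ind {η : BondConfig V | c ∉ cl η.toFinset h₁ ∧ h₂ ∉ cl η.toFinset h₁ ∧ Sep DC (cl η.toFinset h₁) c h₂} η)) ∧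
      0 ≤ (∑ η : BondConfig V, rcWeightW wC q ({h₁, h₂} : Set V) η * ind {η : BondConfig V | c ∉ cl η.toFinset h₁ ∧ h₂ ∈ cl η.toFinset h₁} η) * (q * (∑ η : BondConfig V, rcWeightW wC q ({h₁, h₂} : Set V) η * ind {η : BondConfig V | c ∉ cl η.toFinset h₁ ∧ h₂ ∉ cl η.toFinset h₁ ∧ h₂ ∈ cl η.toFinset c} η)) - (∑ η : BondConfig V, rcWeightW wC q ({h₁, h₂} : Set V) η * ind {η : BondConfig V | c ∈ cl η.toFinset h₁ ∧ h₂ ∈ cl η.toFinset h₁} η) * (q * (∑ η : BondConfig V, rcWeightW wC q ({h₁, h₂} : Set V) η * ind {η : BondConfig V | c ∉ cl η.toFinset h₂ ∧ h₁ ∉ cl η.toFinset h₂ ∧ Sep DC (cl η.toFinset h₂) c h₁} η)) ∧ 0 < (∑ η : BondConfig V, rcWeightW wC q ({h₁, h₂} : Set V) η * ind {η : BondConfig V | c ∈ cl η.toFinset h₁ ∧ h₂ ∈ cl η.toFinset h₁} η) := by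
  have hZ := rcPartitionFunctionW_pos wC hq (∅ : Set V)
  have hZ2 : 0 < rcPartitionFunctionW wC q ∅ * rcPartitionFunctionW wC q ∅ := mul_pos hZ hZ
  have hnn : ∀ (E : Set (BondConfig V)), 0 ≤ ∑ η : BondConfig V, rcWeightW wC q ({h₁, h₂} : Set V) η * ind E η := fun E =>
    Finset.sum_nonneg fun η _ => mul_nonneg (rcWeightW_nonneg wC hq.le _ η) (ind_nonneg E η)
  simp only [rcMeasureW_real_eq_sum_div wC hq] at hR1C hR2C hFC hAC
  rw [ApexTwoSum.free_eq_wired h12 wC q (E := {η : BondConfig V | c ∈ cl η.toFinset h₁ ∧ h₂ ∈ cl η.toFinset h₁}) (fun η hη => hη.2), ApexTwoSum.free_eq_q_wired h12 wC q (E := {η : BondConfig V | c ∉ cl η.toFinset h₁ ∧ h₂ ∉ cl η.toFinset h₁ ∧ Sep DC (cl η.toFinset h₁) c h₂}) (fun η hη => hη.2.1),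
    ApexTwoSum.free_eq_q_wired h12 wC q (E := {η : BondConfig V | c ∈ cl η.toFinset h₁ ∧ h₂ ∉ cl η.toFinset h₁}) (fun η hη => hη.2), ApexTwoSum.free_eq_wired h12 wC q (E := {η : BondConfig V | c ∉ cl η.toFinset h₁ ∧ h₂ ∈ cl η.toFinset h₁}) (fun η hη => hη.2)] at hR1C
  rw [ApexTwoSum.free_eq_wired h12.symm wC q (E := {η : BondConfig V | c ∈ cl η.toFinset h₂ ∧ h₁ ∈ cl η.toFinset h₂}) (fun η hη => hη.2), ApexTwoSum.free_eq_q_wired h12.symm wC q (E := {η : BondConfig V | c ∉ cl η.toFinset h₂ ∧ h₁ ∉ cl η.toFinset h₂ ∧ Sep DC (cl η.toFinset h₂) c h₁}) (fun η hη => hη.2.1),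
    ApexTwoSum.free_eq_q_wired h12.symm wC q (E := {η : BondConfig V | c ∈ cl η.toFinset h₂ ∧ h₁ ∉ cl η.toFinset h₂}) (fun η hη => hη.2), ApexTwoSum.free_eq_wired h12.symm wC q (E := {η : BondConfig V | c ∉ cl η.toFinset h₂ ∧ h₁ ∈ cl η.toFinset h₂}) (fun η hη => hη.2)] at hR2C
  simp only [Set.pair_comm h₂ h₁, ← cellA_symm c h₁ h₂, ← cellB_symm c h₁ h₂, ← cellD_symm c h₁ h₂] at hR2C
  rw [ApexTwoSum.free_eq_wired h12 wC q (E := {η : BondConfig V | c ∉ cl η.toFinset h₁ ∧ h₂ ∈ cl η.toFinset h₁}) (fun η hη => hη.2), ApexTwoSum.free_eq_q_wired h12 wC q (E := {η : BondConfig V | c ∈ cl η.toFinset h₁ ∧ h₂ ∉ cl η.toFinset h₁}) (fun η hη => hη.2),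
    ApexTwoSum.free_eq_q_wired h12 wC q (E := {η : BondConfig V | c ∉ cl η.toFinset h₁ ∧ h₂ ∉ cl η.toFinset h₁ ∧ h₂ ∈ cl η.toFinset c}) (fun η hη => hη.2.1), ApexTwoSum.free_eq_wired h12 wC q (E := {η : BondConfig V | c ∈ cl η.toFinset h₁ ∧ h₂ ∈ cl η.toFinset h₁}) (fun η hη => hη.2),
    ApexTwoSum.free_eq_q_wired h12 wC q (E := {η : BondConfig V | c ∉ cl η.toFinset h₁ ∧ h₂ ∉ cl η.toFinset h₁ ∧ h₂ ∉ cl η.toFinset c}) (fun η hη => hη.2.1)] at hFC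
  rw [ApexTwoSum.free_eq_wired h12 wC q (E := {η : BondConfig V | c ∈ cl η.toFinset h₁ ∧ h₂ ∈ cl η.toFinset h₁}) (fun η hη => hη.2)] at hAC
  refine ⟨?_, ?_, ?_, lt_of_le_of_ne (hnn _) (fun h0 => hAC (by rw [← h0, zero_div]))⟩
  · rw [← add_div, div_mul_div_comm, div_mul_div_comm, div_le_div_iff_of_pos_right hZ2] at hFC
    linarith
  · rw [div_mul_div_comm, div_mul_div_comm, div_le_div_iff_of_pos_right hZ2] at hR1C
    linarith
  · rw [div_mul_div_comm, div_mul_div_comm, div_le_div_iff_of_pos_right hZ2] at hR2C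
    linarith

include h1b h1c hbc h2b h2c hsep hbC hcB hq hw hX hX' hY hY' in
/-- **The wired R1 row** for two terminal arms in parallel (an equality: the wired cells are products). [this work] -/
theorem wired_row : (rcMeasureW w q ({h₁, h₂} : Set V)).real {η : BondConfig V | (b ∈ cl η.toFinset h₁ ∨ b ∈ cl η.toFinset h₂) ∧ (c ∈ cl η.toFinset h₁ ∨ c ∈ cl η.toFinset h₂)} * (rcMeasureW w q ({h₁, h₂} : Set V)).real {η : BondConfig V | ¬ (b ∈ cl η.toFinset h₁ ∨ b ∈ cl η.toFinset h₂) ∧ ¬ (c ∈ cl η.toFinset h₁ ∨ c ∈ cl η.toFinset h₂) ∧ Sep (DB ∪ DC) (cl η.toFinset h₁ ∪ cl η.toFinset h₂) b c} ≤ (rcMeasureW w q ({h₁, h₂} : Set V)).real {η : BondConfig V | (b ∈ cl η.toFinset h₁ ∨ b ∈ cl η.toFinset h₂) ∧ ¬ (c ∈ cl η.toFinset h₁ ∨ c ∈ cl η.toFinset h₂)} * (rcMeasureW w q ({h₁, h₂} : Set V)).real {η : BondConfig V | ¬ (b ∈ cl η.toFinset h₁ ∨ b ∈ cl η.toFinset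 h₂) ∧ (c ∈ cl η.toFinset h₁ ∨ c ∈ cl η.toFinset h₂)} := by
  have hZ := rcPartitionFunctionW_pos w hq ({h₁, h₂} : Set V)
  have hK : 0 < q ^ clusterCount (∅ : BondConfig V) ({h₁, h₂} : Set V) := pow_pos hq _
  obtain ⟨eT, eUb, eUc, eS⟩ := wired_cells h1b h1c h2b h2c hbc hsep hbC hcB w wB wC q hw hX hX' hY hY'
  simp only [rcMeasureW_real_eq_sum_div w hq]
  refine sq_le_div hZ ?_
  refine le_of_mul_le_mul_right (a := q ^ clusterCount (∅ : BondConfig V) ({h₁, h₂} : Set V) * q ^ clusterCount (∅ : BondConfig V) ({h₁, h₂} : Set V)) ?_ (mul_pos hK hK)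
  rw [show ∀ x y K : ℝ, x * y * (K * K) = (x * K) * (y * K) from fun x y K => by ring, eT, eS,
    show ∀ x y K : ℝ, x * y * (K * K) = (x * K) * (y * K) from fun x y K => by ring, eUb, eUc]
  exact le_of_eq (by ring)

include h12 h1b h1c hbc h2b h2c hsep hbC hcB hq hw hX hX' hY hY' in
/-- **CROSS row** `X[φ@h₁, φ@h₂] ≥ 0` for two terminal arms in parallel. [this work] -/
theorem cross_row
  (hR1B : (rcMeasureW wB q ∅).real {η : BondConfig V | b ∈ cl η.toFinset h₁ ∧ h₂ ∈ cl η.toFinset h₁} * (rcMeasureW wB q ∅).real {η : BondConfig V | b ∉ cl η.toFinset h₁ ∧ h₂ ∉ cl η.toFinset h₁ ∧ Sep DB (cl η.toFinset h₁) b h₂} ≤ (rcMeasureW wB q ∅).real {η : BondConfig V | b ∈ cl η.toFinset h₁ ∧ h₂ ∉ cl η.toFinset h₁} * (rcMeasureW wB q ∅).real {η : BondConfig V | b ∉ cl η.toFinset h₁ ∧ h₂ ∈ cl η.toFinset h₁}) (hR2B : (rcMeasureW wB q ∅).real {η : BondConfig V | b ∈ cl η.toFinset h₂ ∧ h₁ ∈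 cl η.toFinset h₂} * (rcMeasureW wB q ∅).real {η : BondConfig V | b ∉ cl η.toFinset h₂ ∧ h₁ ∉ cl η.toFinset h₂ ∧ Sep DB (cl η.toFinset h₂) b h₁} ≤ (rcMeasureW wB q ∅).real {η : BondConfig V | b ∈ cl η.toFinset h₂ ∧ h₁ ∉ cl η.toFinset h₂} * (rcMeasureW wB q ∅).real {η : BondConfig V | b ∉ cl η.toFinset h₂ ∧ h₁ ∈ cl η.toFinset h₂})
  (hFB : (rcMeasureW wB q ∅).real {η : BondConfig V | b ∉ cl η.toFinset h₁ ∧ h₂ ∈ cl η.toFinset h₁} * ((rcMeasureW wB q ∅).real {η : BondConfig V | b ∈ cl η.toFinset h₁ ∧ h₂ ∉ cl η.toFinset h₁} + (rcMeasureW wB q ∅).real {η : BondConfig V | b ∉ cl η.toFinset h₁ ∧ h₂ ∉ cl η.toFinset h₁ ∧ h₂ ∈ cl η.toFinset b}) ≤ (rcMeasureW wB q ∅).real {η : BondConfig V | b ∈ cl η.toFinset h₁ ∧ h₂ ∈ cl η.toFinset h₁} * (rcMeasureW wB q ∅).real {η : BondConfig V | b ∉ cl η.toFinset h₁ ∧ h₂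 ∉ cl η.toFinset h₁ ∧ h₂ ∉ cl η.toFinset b}) (hAB : (rcMeasureW wB q ∅).real {η : BondConfig V | b ∈ cl η.toFinset h₁ ∧ h₂ ∈ cl η.toFinset h₁} ≠ 0)
  (hR1C : (rcMeasureW wC q ∅).real {η : BondConfig V | c ∈ cl η.toFinset h₁ ∧ h₂ ∈ cl η.toFinset h₁} * (rcMeasureW wC q ∅).real {η : BondConfig V | c ∉ cl η.toFinset h₁ ∧ h₂ ∉ cl η.toFinset h₁ ∧ Sep DC (cl η.toFinset h₁) c h₂} ≤ (rcMeasureW wC q ∅).real {η : BondConfig V | c ∈ cl η.toFinset h₁ ∧ h₂ ∉ cl η.toFinset h₁} * (rcMeasureW wC q ∅).real {η : BondConfig V | c ∉ cl η.toFinset h₁ ∧ h₂ ∈ cl η.toFinset h₁}) (hR2C : (rcMeasureW wC q ∅).real {η : BondConfig V | c ∈ cl η.toFinset h₂ ∧ h₁ ∈ cl η.toFinset h₂} * (rcMeasureW wC q ∅).real {η : BondConfig V | c ∉ cl η.toFinset h₂ ∧ h₁ ∉ cl η.toFinset h₂ ∧ Sep DC (cl η.toFinset h₂) c h₁} ≤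 (rcMeasureW wC q ∅).real {η : BondConfig V | c ∈ cl η.toFinset h₂ ∧ h₁ ∉ cl η.toFinset h₂} * (rcMeasureW wC q ∅).real {η : BondConfig V | c ∉ cl η.toFinset h₂ ∧ h₁ ∈ cl η.toFinset h₂})
  (hFC : (rcMeasureW wC q ∅).real {η : BondConfig V | c ∉ cl η.toFinset h₁ ∧ h₂ ∈ cl η.toFinset h₁} * ((rcMeasureW wC q ∅).real {η : BondConfig V | c ∈ cl η.toFinset h₁ ∧ h₂ ∉ cl η.toFinset h₁} + (rcMeasureW wC q ∅).real {η : BondConfig V | c ∉ cl η.toFinset h₁ ∧ h₂ ∉ cl η.toFinset h₁ ∧ h₂ ∈ cl η.toFinset c}) ≤ (rcMeasureW wC q ∅).real {η : BondConfig V | c ∈ cl η.toFinset h₁ ∧ h₂ ∈ cl η.toFinset h₁} * (rcMeasureW wC q ∅).real {η : BondConfig V | c ∉ cl η.toFinset h₁ ∧ h₂ ∉ cl η.toFinset h₁ ∧ h₂ ∉ cl η.toFinset c}) (hAC : (rcMeasureW wC q ∅).real {η : BondConfig V | c ∈ cl η.toFinset h₁ ∧ h₂ ∈ cl η.toFinset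 h₁} ≠ 0) :
    (rcMeasureW w q ∅).real {η : BondConfig V | b ∈ cl η.toFinset h₁ ∧ c ∈ cl η.toFinset h₁} * (rcMeasureW w q ∅).real {η : BondConfig V | b ∉ cl η.toFinset h₂ ∧ c ∉ cl η.toFinset h₂ ∧ Sep (DB ∪ DC) (cl η.toFinset h₂) b c} + (rcMeasureW w q ∅).real {η : BondConfig V | b ∈ cl η.toFinset h₂ ∧ c ∈ cl η.toFinset h₂} * (rcMeasureW w q ∅).real {η : BondConfig V | b ∉ cl η.toFinset h₁ ∧ c ∉ cl η.toFinset h₁ ∧ Sep (DB ∪ DC) (cl η.toFinset h₁) b c} ≤ (rcMeasureW w q ∅).real {η : BondConfig V | b ∈ cl η.toFinset h₁ ∧ c ∉ cl η.toFinset h₁} * (rcMeasureW w q ∅).real {η : BondConfig V | b ∉ cl η.toFinset h₂ ∧ c ∈ cl η.toFinset h₂} + (rcMeasureW w q ∅).real {η : BondConfig V | b ∈ cl η.toFinset h₂ ∧ c ∉ cl η.toFinset h₂} * (rcMeasureW w q ∅).real {η : BondConfig V | b ∉ cl η.toFinset h₁ ∧ c ∈ cl η.toFinset h₁} := by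
  obtain ⟨φB, ρB, σB, pXA⟩ := armB_slacks h12 wB hq hR1B hR2B hFB hAB
  obtain ⟨φC, ρC, σC, pYA⟩ := armC_slacks h12 wC hq hR1C hR2C hFC hAC
  have hZ := rcPartitionFunctionW_pos w hq (∅ : Set V)
  have hK : 0 < q ^ clusterCount (∅ : BondConfig V) ({h₁, h₂} : Set V) := pow_pos hq _
  have hnnB : ∀ (E : Set (BondConfig V)), 0 ≤ ∑ η : BondConfig V, rcWeightW wB q ({h₁, h₂} : Set V) η * ind E η := fun E =>
    Finset.sum_nonneg fun η _ => mul_nonneg (rcWeightW_nonneg wB hq.le _ η) (ind_nonneg E η)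
  have hnnC : ∀ (E : Set (BondConfig V)), 0 ≤ ∑ η : BondConfig V, rcWeightW wC q ({h₁, h₂} : Set V) η * ind E η := fun E =>
    Finset.sum_nonneg fun η _ => mul_nonneg (rcWeightW_nonneg wC hq.le _ η) (ind_nonneg E η)
  have hsep' : ∀ z : V, (∃ e ∈ DB, z ∈ e) → (∃ e ∈ DC, z ∈ e) → (z = h₂ ∨ z = h₁) := fun z h1 h2 => (hsep z h1 h2).symm
  have eT1 := ApexTwoSum.glued_T_sum h12 h1b h1c hsep hbC hcB w wB wC q hw hX hX' hY hY'
  have eUb1 := ApexTwoSum.glued_Ub_sum h12 h1b h1c hsep hbC hcB w wB wC q hw hX hX' hY hY'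
  have eUc1 := ApexTwoSum.glued_Uc_sum h12 h1b h1c hsep hbC hcB w wB wC q hw hX hX' hY hY'
  have eS1 := ApexTwoSum.glued_S_sum h12 h1b h1c hbc h2b h2c hsep hbC hcB w wB wC q hw hX hX' hY hY'
  have eT2 := ApexTwoSum.glued_T_sum h12.symm h2b h2c hsep' hbC hcB w wB wC q hw hX hX' hY hY'
  have eUb2 := ApexTwoSum.glued_Ub_sum h12.symm h2b h2c hsep' hbC hcB w wB wC q hw hX hX' hY hY'
  have eUc2 := ApexTwoSum.glued_Uc_sum h12.symm h2b h2c hsep' hbC hcB w wB wC q hw hX hX' hY hY'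
  have eS2 := ApexTwoSum.glued_S_sum h12.symm h2b h2c hbc h1b h1c hsep' hbC hcB w wB wC q hw hX hX' hY hY'
  simp only [Set.pair_comm h₂ h₁, ← cellA_symm b h₁ h₂, ← cellB_symm b h₁ h₂, ← cellC_symm b h₁ h₂, ← cellD_symm b h₁ h₂, ← cellE_symm b h₁ h₂, ← cellA_symm c h₁ h₂, ← cellB_symm c h₁ h₂, ← cellC_symm c h₁ h₂, ← cellD_symm c h₁ h₂, ← cellE_symm c h₁ h₂] at eT2 eUb2 eUc2 eS2
  simp only [rcMeasureW_real_eq_sum_div w hq]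
  refine polar_le_div hZ hZ ?_
  refine le_of_mul_le_mul_right (a := q ^ clusterCount (∅ : BondConfig V) ({h₁, h₂} : Set V) * q ^ clusterCount (∅ : BondConfig V) ({h₁, h₂} : Set V)) ?_ (mul_pos hK hK)
  rw [show ∀ x y x' y' K : ℝ, (x * y + x' * y') * (K * K) = (x * K) * (y * K) + (x' * K) * (y' * K) from fun _ _ _ _ _ => by ring,
    eT1, eS2, eT2, eS1,
    show ∀ x y x' y' K : ℝ, (x * y + x' * y') * (K * K) = (x * K) * (y * K) + (x' * K) * (y' * K) from fun _ _ _ _ _ => by ring,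
    eUb1, eUc2, eUb2, eUc1]
  set XA := (∑ η : BondConfig V, rcWeightW wB q ({h₁, h₂} : Set V) η * ind {η : BondConfig V | b ∈ cl η.toFinset h₁ ∧ h₂ ∈ cl η.toFinset h₁} η) with hXA
  set XB := (∑ η : BondConfig V, rcWeightW wB q ({h₁, h₂} : Set V) η * ind {η : BondConfig V | b ∉ cl η.toFinset h₁ ∧ h₂ ∈ cl η.toFinset h₁} η) with hXB
  set XC := (∑ η : BondConfig V, rcWeightW wB q ({h₁, h₂} : Set V) η * ind {η : BondConfig V | b ∈ cl η.toFinset h₁ ∧ h₂ ∉ cl η.toFinset h₁} η) with hXC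
  set XD := (∑ η : BondConfig V, rcWeightW wB q ({h₁, h₂} : Set V) η * ind {η : BondConfig V | b ∉ cl η.toFinset h₁ ∧ h₂ ∉ cl η.toFinset h₁ ∧ h₂ ∈ cl η.toFinset b} η) with hXD
  set XE := (∑ η : BondConfig V, rcWeightW wB q ({h₁, h₂} : Set V) η * ind {η : BondConfig V | b ∉ cl η.toFinset h₁ ∧ h₂ ∉ cl η.toFinset h₁ ∧ h₂ ∉ cl η.toFinset b} η) with hXE
  set XN := (∑ η : BondConfig V, rcWeightW wB q ({h₁, h₂} : Set V) η * ind {η : BondConfig V | b ∉ cl η.toFinset h₁ ∧ h₂ ∉ cl η.toFinset h₁ ∧ Sep DB (cl η.toFinset h₁) b h₂} η) with hXN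
  set XM := (∑ η : BondConfig V, rcWeightW wB q ({h₁, h₂} : Set V) η * ind {η : BondConfig V | b ∉ cl η.toFinset h₂ ∧ h₁ ∉ cl η.toFinset h₂ ∧ Sep DB (cl η.toFinset h₂) b h₁} η) with hXM
  set YA := (∑ η : BondConfig V, rcWeightW wC q ({h₁, h₂} : Set V) η * ind {η : BondConfig V | c ∈ cl η.toFinset h₁ ∧ h₂ ∈ cl η.toFinset h₁} η) with hYA
  set YB := (∑ η : BondConfig V, rcWeightW wC q ({h₁, h₂} : Set V) η * ind {η : BondConfig V | c ∉ cl η.toFinset h₁ ∧ h₂ ∈ cl η.toFinset h₁} η) with hYB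
  set YC := (∑ η : BondConfig V, rcWeightW wC q ({h₁, h₂} : Set V) η * ind {η : BondConfig V | c ∈ cl η.toFinset h₁ ∧ h₂ ∉ cl η.toFinset h₁} η) with hYC
  set YD := (∑ η : BondConfig V, rcWeightW wC q ({h₁, h₂} : Set V) η * ind {η : BondConfig V | c ∉ cl η.toFinset h₁ ∧ h₂ ∉ cl η.toFinset h₁ ∧ h₂ ∈ cl η.toFinset c} η) with hYD
  set YE := (∑ η : BondConfig V, rcWeightW wC q ({h₁, h₂} : Set V) η * ind {η : BondConfig V | c ∉ cl η.toFinset h₁ ∧ h₂ ∉ cl η.toFinset h₁ ∧ h₂ ∉ cl η.toFinset c} η) with hYE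
  set YN := (∑ η : BondConfig V, rcWeightW wC q ({h₁, h₂} : Set V) η * ind {η : BondConfig V | c ∉ cl η.toFinset h₁ ∧ h₂ ∉ cl η.toFinset h₁ ∧ Sep DC (cl η.toFinset h₁) c h₂} η) with hYN
  set YM := (∑ η : BondConfig V, rcWeightW wC q ({h₁, h₂} : Set V) η * ind {η : BondConfig V | c ∉ cl η.toFinset h₂ ∧ h₁ ∉ cl η.toFinset h₂ ∧ Sep DC (cl η.toFinset h₂) c h₁} η) with hYM
  have cert := ThetaBlocks.CROSS_cert XA XB (q * XC) (q * XD) (q * XE) (q * XN) (q * XM) YA YB (q * YC) (q * YD) (q * YE) (q * YN) (q * YM) q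
    (hnnB _) (hnnB _) (mul_nonneg hq.le (hnnB _)) (mul_nonneg hq.le (hnnB _)) (hnnC _) (hnnC _)
    (mul_nonneg hq.le (hnnC _)) (mul_nonneg hq.le (hnnC _)) hq.le
    _ _ _ _ _ _ rfl rfl rfl rfl rfl rfl φB ρB σB φC ρC σC
    _ _ _ _ _ rfl rfl rfl rfl rfl _ _ _ _ rfl rfl rfl rfl _ _ _ _ rfl rfl rfl rfl
  have hpos : 0 < XA * YA * q ^ 2 := by positivity
  refine le_of_mul_le_mul_left (a := XA * YA * q ^ 2) ?_ hpos
  have key : XA * YA * q ^ 2 * ((XA * YB + XA * YE + XC * YB + q * (XC * YD) + q * (XC * YE) + XD * YB) * (XB * YA + XE * YA + XB * YD + q * (XC * YD) + q * (XE * YD) + XB * YC) + (XA * YB + XA * YE + XD * YB + q * (XD * YC) + q * (XD * YE) + XC * YB) * (XB * YA + XE * YA + XB * YC + q * (XD * YC) + q * (XE * YC) + XB * YD)) - XA * YA * q ^ 2 * ((XA * YA + XA * YC + XA * YD + XC * YA + q * (XC * YC) + XD * YA) * (XB * YB + XB * YE + XE * YB + q * (XM * YC) + q * (XM * YE) + q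 * (XC * YM) + q * (XE * YM) - q * (XM * YM)) + (XA * YA + XA * YD + XA * YC + XD * YA + q * (XD * YD) + XC * YA) * (XB * YB + XB * YE + XE * YB + q * (XN * YD) + q * (XN * YE) + q * (XD * YN) + q * (XE * YN) - q * (XN * YN))) = XA * YA * ((q * XA * (YA + YB) + XA * ((q*YC) + (q*YD) + (q*YE)) + ((q*XC) + (q*XD)) * (YA + YB) + (q*XC) * ((q*YC) + (q*YD) + (q*YE))) * (q * YA * (XA + XB) + YA * ((q*XC) + (q*XD) + (q*XE)) + ((q*YC) + (q*YD)) * (XA + XB) + (q*YD) * ((q*XC) + (q*XD) + (q*XE))) + (q * XA * (YA + YB) + XA * ((q*YC) + (q*YD) + (q*YE)) + ((q*XC) + (q*XD)) * (YA + YB) + (q*XD) * ((q*YC) + (q*YD) + (q*YE))) * (q * YA * (XA + XB) + YA * ((q*XC) + (q*XD) + (q*XE)) + ((q*YC) + (q*YD)) * (XA + XB) + (q*YC) * ((q*XC) + (q*XD) + (q*XE))) - (q * XA * YA + XA * ((q*YC) + (q*YD)) + ((q*XC) + (q*XD)) * YA + (q*XC) * (q*YC)) * ((q * (XA + XB) *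 (YA + YB) + (XA + XB) * ((q*YC) + (q*YD) + (q*YE)) + ((q*XC) + (q*XD) + (q*XE)) * (YA + YB) + ((q*XC) + (q*XD) + (q*XE)) * ((q*YC) + (q*YD) + (q*YE))) - (((q*XC) + (q*XD) + (q*XE)) - (q*XD) - (q*XM)) * (((q*YC) + (q*YD) + (q*YE)) - (q*YD) - (q*YM))) - (q * XA * YA + XA * ((q*YC) + (q*YD)) + ((q*XC) + (q*XD)) * YA + (q*XD) * (q*YD)) * ((q * (XA + XB) * (YA + YB) + (XA + XB) * ((q*YC) + (q*YD) + (q*YE)) + ((q*XC) + (q*XD) + (q*XE)) * (YA + YB) + ((q*XC) + (q*XD) + (q*XE)) * ((q*YC) + (q*YD) + (q*YE))) - (((q*XC) + (q*XD) + (q*XE)) - (q*XC) - (q*XN)) * (((q*YC) + (q*YD) + (q*YE)) - (q*YC) - (q*YN)))) := by ring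
  linarith [cert, key]

include h12 h1b h1c hbc h2b h2c hsep hbC hcB hq hw hX hX' hY hY' in
/-- **W⁰ row** `X[φ_w, φ@h₁] ≥ 0` for two terminal arms in parallel. [this work] -/
theorem w0_row
  (hR1B : (rcMeasureW wB q ∅).real {η : BondConfig V | b ∈ cl η.toFinset h₁ ∧ h₂ ∈ cl η.toFinset h₁} * (rcMeasureW wB q ∅).real {η : BondConfig V | b ∉ cl η.toFinset h₁ ∧ h₂ ∉ cl η.toFinset h₁ ∧ Sep DB (cl η.toFinset h₁) b h₂} ≤ (rcMeasureW wB q ∅).real {η : BondConfig V | b ∈ cl η.toFinset h₁ ∧ h₂ ∉ cl η.toFinset h₁} * (rcMeasureW wB q ∅).real {η : BondConfig V | b ∉ cl η.toFinset h₁ ∧ h₂ ∈ cl η.toFinset h₁}) (hR2B : (rcMeasureW wB q ∅).real {η : BondConfig V | b ∈ cl η.toFinset h₂ ∧ h₁ ∈ cl η.toFinset h₂} * (rcMeasureW wB q ∅).real {η : BondConfig V | b ∉ cl η.toFinset h₂ ∧ h₁ ∉ cl η.toFinset h₂ ∧ Sep DB (cl η.toFinset h₂) b h₁} ≤ (rcMeasureW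 wB q ∅).real {η : BondConfig V | b ∈ cl η.toFinset h₂ ∧ h₁ ∉ cl η.toFinset h₂} * (rcMeasureW wB q ∅).real {η : BondConfig V | b ∉ cl η.toFinset h₂ ∧ h₁ ∈ cl η.toFinset h₂})
  (hFB : (rcMeasureW wB q ∅).real {η : BondConfig V | b ∉ cl η.toFinset h₁ ∧ h₂ ∈ cl η.toFinset h₁} * ((rcMeasureW wB q ∅).real {η : BondConfig V | b ∈ cl η.toFinset h₁ ∧ h₂ ∉ cl η.toFinset h₁} + (rcMeasureW wB q ∅).real {η : BondConfig V | b ∉ cl η.toFinset h₁ ∧ h₂ ∉ cl η.toFinset h₁ ∧ h₂ ∈ cl η.toFinset b}) ≤ (rcMeasureW wB q ∅).real {η : BondConfig V | b ∈ cl η.toFinset h₁ ∧ h₂ ∈ cl η.toFinset h₁} * (rcMeasureW wB q ∅).real {η : BondConfig V | b ∉ cl η.toFinset h₁ ∧ h₂ ∉ cl η.toFinset h₁ ∧ h₂ ∉ cl η.toFinset b}) (hAB : (rcMeasureW wB q ∅).real {η : BondConfig V | b ∈ cl η.toFinset h₁ ∧ h₂ ∈ cl η.toFinset h₁} ≠ 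0)
  (hR1C : (rcMeasureW wC q ∅).real {η : BondConfig V | c ∈ cl η.toFinset h₁ ∧ h₂ ∈ cl η.toFinset h₁} * (rcMeasureW wC q ∅).real {η : BondConfig V | c ∉ cl η.toFinset h₁ ∧ h₂ ∉ cl η.toFinset h₁ ∧ Sep DC (cl η.toFinset h₁) c h₂} ≤ (rcMeasureW wC q ∅).real {η : BondConfig V | c ∈ cl η.toFinset h₁ ∧ h₂ ∉ cl η.toFinset h₁} * (rcMeasureW wC q ∅).real {η : BondConfig V | c ∉ cl η.toFinset h₁ ∧ h₂ ∈ cl η.toFinset h₁}) (hR2C : (rcMeasureW wC q ∅).real {η : BondConfig V | c ∈ cl η.toFinset h₂ ∧ h₁ ∈ cl η.toFinset h₂} * (rcMeasureW wC q ∅).real {η : BondConfig V | c ∉ cl η.toFinset h₂ ∧ h₁ ∉ cl η.toFinset h₂ ∧ Sep DC (cl η.toFinset h₂) c h₁} ≤ (rcMeasureW wC q ∅).real {η : BondConfig V | c ∈ cl η.toFinset h₂ ∧ h₁ ∉ cl η.toFinset h₂} * (rcMeasureW wC q ∅).real {η : BondConfig V | c ∉ cl η.toFinset h₂ ∧ h₁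 ∈ cl η.toFinset h₂})
  (hFC : (rcMeasureW wC q ∅).real {η : BondConfig V | c ∉ cl η.toFinset h₁ ∧ h₂ ∈ cl η.toFinset h₁} * ((rcMeasureW wC q ∅).real {η : BondConfig V | c ∈ cl η.toFinset h₁ ∧ h₂ ∉ cl η.toFinset h₁} + (rcMeasureW wC q ∅).real {η : BondConfig V | c ∉ cl η.toFinset h₁ ∧ h₂ ∉ cl η.toFinset h₁ ∧ h₂ ∈ cl η.toFinset c}) ≤ (rcMeasureW wC q ∅).real {η : BondConfig V | c ∈ cl η.toFinset h₁ ∧ h₂ ∈ cl η.toFinset h₁} * (rcMeasureW wC q ∅).real {η : BondConfig V | c ∉ cl η.toFinset h₁ ∧ h₂ ∉ cl η.toFinset h₁ ∧ h₂ ∉ cl η.toFinset c}) (hAC : (rcMeasureW wC q ∅).real {η : BondConfig V | c ∈ cl η.toFinset h₁ ∧ h₂ ∈ cl η.toFinset h₁} ≠ 0) :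
    (rcMeasureW w q ({h₁, h₂} : Set V)).real {η : BondConfig V | (b ∈ cl η.toFinset h₁ ∨ b ∈ cl η.toFinset h₂) ∧ (c ∈ cl η.toFinset h₁ ∨ c ∈ cl η.toFinset h₂)} * (rcMeasureW w q ∅).real {η : BondConfig V | b ∉ cl η.toFinset h₁ ∧ c ∉ cl η.toFinset h₁ ∧ Sep (DB ∪ DC) (cl η.toFinset h₁) b c} + (rcMeasureW w q ∅).real {η : BondConfig V | b ∈ cl η.toFinset h₁ ∧ c ∈ cl η.toFinset h₁} * (rcMeasureW w q ({h₁, h₂} : Set V)).real {η : BondConfig V | ¬ (b ∈ cl η.toFinset h₁ ∨ b ∈ cl η.toFinset h₂) ∧ ¬ (c ∈ cl η.toFinset h₁ ∨ c ∈ cl η.toFinset h₂) ∧ Sep (DB ∪ DC) (cl η.toFinset h₁ ∪ cl η.toFinset h₂) b c} ≤ (rcMeasureW w q ({h₁, h₂} : Set V)).real {η : BondConfig V | (b ∈ cl η.toFinset h₁ ∨ b ∈ cl η.toFinset h₂) ∧ ¬ (c ∈ cl η.toFinset h₁ ∨ c ∈ cl η.toFinset h₂)} * (rcMeasureW w q ∅).real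 {η : BondConfig V | b ∉ cl η.toFinset h₁ ∧ c ∈ cl η.toFinset h₁} + (rcMeasureW w q ∅).real {η : BondConfig V | b ∈ cl η.toFinset h₁ ∧ c ∉ cl η.toFinset h₁} * (rcMeasureW w q ({h₁, h₂} : Set V)).real {η : BondConfig V | ¬ (b ∈ cl η.toFinset h₁ ∨ b ∈ cl η.toFinset h₂) ∧ (c ∈ cl η.toFinset h₁ ∨ c ∈ cl η.toFinset h₂)} := by
  obtain ⟨φB, ρB, σB, pXA⟩ := armB_slacks h12 wB hq hR1B hR2B hFB hAB
  obtain ⟨φC, ρC, σC, pYA⟩ := armC_slacks h12 wC hq hR1C hR2C hFC hAC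
  have hZ := rcPartitionFunctionW_pos w hq (∅ : Set V)
  have hZw := rcPartitionFunctionW_pos w hq ({h₁, h₂} : Set V)
  have hK : 0 < q ^ clusterCount (∅ : BondConfig V) ({h₁, h₂} : Set V) := pow_pos hq _
  have hnnB : ∀ (E : Set (BondConfig V)), 0 ≤ ∑ η : BondConfig V, rcWeightW wB q ({h₁, h₂} : Set V) η * ind E η := fun E =>
    Finset.sum_nonneg fun η _ => mul_nonneg (rcWeightW_nonneg wB hq.le _ η) (ind_nonneg E η)
  have hnnC : ∀ (E : Set (BondConfig V)), 0 ≤ ∑ η : BondConfig V, rcWeightW wC q ({h₁, h₂} : Set V) η * ind E η := fun E =>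
    Finset.sum_nonneg fun η _ => mul_nonneg (rcWeightW_nonneg wC hq.le _ η) (ind_nonneg E η)
  have eT1 := ApexTwoSum.glued_T_sum h12 h1b h1c hsep hbC hcB w wB wC q hw hX hX' hY hY'
  have eUb1 := ApexTwoSum.glued_Ub_sum h12 h1b h1c hsep hbC hcB w wB wC q hw hX hX' hY hY'
  have eUc1 := ApexTwoSum.glued_Uc_sum h12 h1b h1c hsep hbC hcB w wB wC q hw hX hX' hY hY'
  have eS1 := ApexTwoSum.glued_S_sum h12 h1b h1c hbc h2b h2c hsep hbC hcB w wB wC q hw hX hX' hY hY'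
  obtain ⟨wT, wUb, wUc, wS⟩ := wired_cells h1b h1c h2b h2c hbc hsep hbC hcB w wB wC q hw hX hX' hY hY'
  simp only [rcMeasureW_real_eq_sum_div w hq]
  refine polar_le_div hZw hZ ?_
  refine le_of_mul_le_mul_right (a := q ^ clusterCount (∅ : BondConfig V) ({h₁, h₂} : Set V) * q ^ clusterCount (∅ : BondConfig V) ({h₁, h₂} : Set V)) ?_ (mul_pos hK hK)
  rw [show ∀ x y x' y' K : ℝ, (x * y + x' * y') * (K * K) = (x * K) * (y * K) + (x' * K) * (y' * K) from fun _ _ _ _ _ => by ring,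
    wT, eS1, eT1, wS,
    show ∀ x y x' y' K : ℝ, (x * y + x' * y') * (K * K) = (x * K) * (y * K) + (x' * K) * (y' * K) from fun _ _ _ _ _ => by ring,
    wUb, eUc1, eUb1, wUc, xT_split q wB b, xT'_split q wB b, xT_split q wC c, xT'_split q wC c]
  set XA := (∑ η : BondConfig V, rcWeightW wB q ({h₁, h₂} : Set V) η * ind {η : BondConfig V | b ∈ cl η.toFinset h₁ ∧ h₂ ∈ cl η.toFinset h₁} η) with hXA
  set XB := (∑ η : BondConfig V, rcWeightW wB q ({h₁, h₂} : Set V) η * ind {η : BondConfig V | b ∉ cl η.toFinset h₁ ∧ h₂ ∈ cl η.toFinset h₁} η) with hXB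
  set XC := (∑ η : BondConfig V, rcWeightW wB q ({h₁, h₂} : Set V) η * ind {η : BondConfig V | b ∈ cl η.toFinset h₁ ∧ h₂ ∉ cl η.toFinset h₁} η) with hXC
  set XD := (∑ η : BondConfig V, rcWeightW wB q ({h₁, h₂} : Set V) η * ind {η : BondConfig V | b ∉ cl η.toFinset h₁ ∧ h₂ ∉ cl η.toFinset h₁ ∧ h₂ ∈ cl η.toFinset b} η) with hXD
  set XE := (∑ η : BondConfig V, rcWeightW wB q ({h₁, h₂} : Set V) η * ind {η : BondConfig V | b ∉ cl η.toFinset h₁ ∧ h₂ ∉ cl η.toFinset h₁ ∧ h₂ ∉ cl η.toFinset b} η) with hXE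
  set XN := (∑ η : BondConfig V, rcWeightW wB q ({h₁, h₂} : Set V) η * ind {η : BondConfig V | b ∉ cl η.toFinset h₁ ∧ h₂ ∉ cl η.toFinset h₁ ∧ Sep DB (cl η.toFinset h₁) b h₂} η) with hXN
  set XM := (∑ η : BondConfig V, rcWeightW wB q ({h₁, h₂} : Set V) η * ind {η : BondConfig V | b ∉ cl η.toFinset h₂ ∧ h₁ ∉ cl η.toFinset h₂ ∧ Sep DB (cl η.toFinset h₂) b h₁} η) with hXM
  set YA := (∑ η : BondConfig V, rcWeightW wC q ({h₁, h₂} : Set V) η * ind {η : BondConfig V | c ∈ cl η.toFinset h₁ ∧ h₂ ∈ cl η.toFinset h₁} η) with hYA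
  set YB := (∑ η : BondConfig V, rcWeightW wC q ({h₁, h₂} : Set V) η * ind {η : BondConfig V | c ∉ cl η.toFinset h₁ ∧ h₂ ∈ cl η.toFinset h₁} η) with hYB
  set YC := (∑ η : BondConfig V, rcWeightW wC q ({h₁, h₂} : Set V) η * ind {η : BondConfig V | c ∈ cl η.toFinset h₁ ∧ h₂ ∉ cl η.toFinset h₁} η) with hYC
  set YD := (∑ η : BondConfig V, rcWeightW wC q ({h₁, h₂} : Set V) η * ind {η : BondConfig V | c ∉ cl η.toFinset h₁ ∧ h₂ ∉ cl η.toFinset h₁ ∧ h₂ ∈ cl η.toFinset c} η) with hYD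
  set YE := (∑ η : BondConfig V, rcWeightW wC q ({h₁, h₂} : Set V) η * ind {η : BondConfig V | c ∉ cl η.toFinset h₁ ∧ h₂ ∉ cl η.toFinset h₁ ∧ h₂ ∉ cl η.toFinset c} η) with hYE
  set YN := (∑ η : BondConfig V, rcWeightW wC q ({h₁, h₂} : Set V) η * ind {η : BondConfig V | c ∉ cl η.toFinset h₁ ∧ h₂ ∉ cl η.toFinset h₁ ∧ Sep DC (cl η.toFinset h₁) c h₂} η) with hYN
  set YM := (∑ η : BondConfig V, rcWeightW wC q ({h₁, h₂} : Set V) η * ind {η : BondConfig V | c ∉ cl η.toFinset h₂ ∧ h₁ ∉ cl η.toFinset h₂ ∧ Sep DC (cl η.toFinset h₂) c h₁} η) with hYM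
  have cert := ThetaBlocks.W0_cert XA XB (q * XC) (q * XD) (q * XE) (q * XN) YA YB (q * YC) (q * YD) (q * YE) (q * YN) q
    (hnnB _) (hnnB _) (mul_nonneg hq.le (hnnB _)) (mul_nonneg hq.le (hnnB _)) (hnnC _) (hnnC _)
    (mul_nonneg hq.le (hnnC _)) (mul_nonneg hq.le (hnnC _)) hq.le
    _ _ _ _ rfl rfl rfl rfl φB ρB φC ρC
    _ _ _ _ _ rfl rfl rfl rfl rfl _ _ _ _ rfl rfl rfl rfl _ _ _ _ rfl rfl rfl rfl
  have hpos : 0 < XA * YA * q ^ 3 := by positivity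
  refine le_of_mul_le_mul_left (a := XA * YA * q ^ 3) ?_ hpos
  have key : XA * YA * q ^ 3 * (((XA + XC + XD) * (YB + YE)) * (XB * YA + XE * YA + XB * YC + q * (XD * YC) + q * (XE * YC) + XB * YD) + (XA * YB + XA * YE + XC * YB + q * (XC * YD) + q * (XC * YE) + XD * YB) * ((XB + XE) * (YA + YC + YD))) - XA * YA * q ^ 3 * (((XA + XC + XD) * (YA + YC + YD)) * (XB * YB + XB * YE + XE * YB + q * (XN * YD) + q * (XN * YE) + q * (XD * YN) + q * (XE * YN) - q * (XN * YN)) + (XA * YA + XA * YC + XA * YD + XC * YA + q * (XC * YC) + XD * YA) * ((XB + XE) * (YB + YE))) = XA * YA * ((q * YA + (q*YC) + (q*YD)) * ((q * XA + (q*XC) + (q*XD)) + (q * XB + (q*XE))) * (q * XA * (YA + YB) + XA * ((q*YC) + (q*YD) + (q*YE)) + ((q*XC) + (q*XD)) * (YA + YB) + (q*XC) * ((q*YC) + (q*YD) + (q*YE))) + (q * XA + (q*XC) + (q*XD)) * ((q * YA + (q*YC) + (q*YD)) + (q * YB + (q*YE))) * (q * YA * (XA + XB) + YA * ((q*XC)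 + (q*XD) + (q*XE)) + ((q*YC) + (q*YD)) * (XA + XB) + (q*YC) * ((q*XC) + (q*XD) + (q*XE))) - ((q * XA + (q*XC) + (q*XD)) + (q * XB + (q*XE))) * ((q * YA + (q*YC) + (q*YD)) + (q * YB + (q*YE))) * (q * XA * YA + XA * ((q*YC) + (q*YD)) + ((q*XC) + (q*XD)) * YA + (q*XC) * (q*YC)) - (q * XA + (q*XC) + (q*XD)) * (q * YA + (q*YC) + (q*YD)) * ((q * (XA + XB) * (YA + YB) + (XA + XB) * ((q*YC) + (q*YD) + (q*YE)) + ((q*XC) + (q*XD) + (q*XE)) * (YA + YB) + ((q*XC) + (q*XD) + (q*XE)) * ((q*YC) + (q*YD) + (q*YE))) - (((q*XC) + (q*XD) + (q*XE)) - (q*XC) - (q*XN)) * (((q*YC) + (q*YD) + (q*YE)) - (q*YC) - (q*YN)))) := by ring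
  linarith [cert, key]

include h12 h1b h1c hbc h2b h2c hsep hbC hcB hq hw hX hX' hY hY' in
/-- **W¹ row** `X[φ_w, φ@h₂] ≥ 0` for two terminal arms in parallel. [this work] -/
theorem w1_row
  (hR1B : (rcMeasureW wB q ∅).real {η : BondConfig V | b ∈ cl η.toFinset h₁ ∧ h₂ ∈ cl η.toFinset h₁} * (rcMeasureW wB q ∅).real {η : BondConfig V | b ∉ cl η.toFinset h₁ ∧ h₂ ∉ cl η.toFinset h₁ ∧ Sep DB (cl η.toFinset h₁) b h₂} ≤ (rcMeasureW wB q ∅).real {η : BondConfig V | b ∈ cl η.toFinset h₁ ∧ h₂ ∉ cl η.toFinset h₁} * (rcMeasureW wB q ∅).real {η : BondConfig V | b ∉ cl η.toFinset h₁ ∧ h₂ ∈ cl η.toFinset h₁}) (hR2B : (rcMeasureW wB q ∅).real {η : BondConfig V | b ∈ cl η.toFinset h₂ ∧ h₁ ∈ cl η.toFinset h₂} * (rcMeasureW wB q ∅).real {η : BondConfig V | b ∉ cl η.toFinset h₂ ∧ h₁ ∉ cl η.toFinset h₂ ∧ Sep DB (cl η.toFinset h₂) b h₁} ≤ (rcMeasureW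 wB q ∅).real {η : BondConfig V | b ∈ cl η.toFinset h₂ ∧ h₁ ∉ cl η.toFinset h₂} * (rcMeasureW wB q ∅).real {η : BondConfig V | b ∉ cl η.toFinset h₂ ∧ h₁ ∈ cl η.toFinset h₂})
  (hFB : (rcMeasureW wB q ∅).real {η : BondConfig V | b ∉ cl η.toFinset h₁ ∧ h₂ ∈ cl η.toFinset h₁} * ((rcMeasureW wB q ∅).real {η : BondConfig V | b ∈ cl η.toFinset h₁ ∧ h₂ ∉ cl η.toFinset h₁} + (rcMeasureW wB q ∅).real {η : BondConfig V | b ∉ cl η.toFinset h₁ ∧ h₂ ∉ cl η.toFinset h₁ ∧ h₂ ∈ cl η.toFinset b}) ≤ (rcMeasureW wB q ∅).real {η : BondConfig V | b ∈ cl η.toFinset h₁ ∧ h₂ ∈ cl η.toFinset h₁} * (rcMeasureW wB q ∅).real {η : BondConfig V | b ∉ cl η.toFinset h₁ ∧ h₂ ∉ cl η.toFinset h₁ ∧ h₂ ∉ cl η.toFinset b}) (hAB : (rcMeasureW wB q ∅).real {η : BondConfig V | b ∈ cl η.toFinset h₁ ∧ h₂ ∈ cl η.toFinset h₁} ≠ 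0)
  (hR1C : (rcMeasureW wC q ∅).real {η : BondConfig V | c ∈ cl η.toFinset h₁ ∧ h₂ ∈ cl η.toFinset h₁} * (rcMeasureW wC q ∅).real {η : BondConfig V | c ∉ cl η.toFinset h₁ ∧ h₂ ∉ cl η.toFinset h₁ ∧ Sep DC (cl η.toFinset h₁) c h₂} ≤ (rcMeasureW wC q ∅).real {η : BondConfig V | c ∈ cl η.toFinset h₁ ∧ h₂ ∉ cl η.toFinset h₁} * (rcMeasureW wC q ∅).real {η : BondConfig V | c ∉ cl η.toFinset h₁ ∧ h₂ ∈ cl η.toFinset h₁}) (hR2C : (rcMeasureW wC q ∅).real {η : BondConfig V | c ∈ cl η.toFinset h₂ ∧ h₁ ∈ cl η.toFinset h₂} * (rcMeasureW wC q ∅).real {η : BondConfig V | c ∉ cl η.toFinset h₂ ∧ h₁ ∉ cl η.toFinset h₂ ∧ Sep DC (cl η.toFinset h₂) c h₁} ≤ (rcMeasureW wC q ∅).real {η : BondConfig V | c ∈ cl η.toFinset h₂ ∧ h₁ ∉ cl η.toFinset h₂} * (rcMeasureW wC q ∅).real {η : BondConfig V | c ∉ cl η.toFinset h₂ ∧ h₁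 ∈ cl η.toFinset h₂})
  (hFC : (rcMeasureW wC q ∅).real {η : BondConfig V | c ∉ cl η.toFinset h₁ ∧ h₂ ∈ cl η.toFinset h₁} * ((rcMeasureW wC q ∅).real {η : BondConfig V | c ∈ cl η.toFinset h₁ ∧ h₂ ∉ cl η.toFinset h₁} + (rcMeasureW wC q ∅).real {η : BondConfig V | c ∉ cl η.toFinset h₁ ∧ h₂ ∉ cl η.toFinset h₁ ∧ h₂ ∈ cl η.toFinset c}) ≤ (rcMeasureW wC q ∅).real {η : BondConfig V | c ∈ cl η.toFinset h₁ ∧ h₂ ∈ cl η.toFinset h₁} * (rcMeasureW wC q ∅).real {η : BondConfig V | c ∉ cl η.toFinset h₁ ∧ h₂ ∉ cl η.toFinset h₁ ∧ h₂ ∉ cl η.toFinset c}) (hAC : (rcMeasureW wC q ∅).real {η : BondConfig V | c ∈ cl η.toFinset h₁ ∧ h₂ ∈ cl η.toFinset h₁} ≠ 0) :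
    (rcMeasureW w q ({h₁, h₂} : Set V)).real {η : BondConfig V | (b ∈ cl η.toFinset h₁ ∨ b ∈ cl η.toFinset h₂) ∧ (c ∈ cl η.toFinset h₁ ∨ c ∈ cl η.toFinset h₂)} * (rcMeasureW w q ∅).real {η : BondConfig V | b ∉ cl η.toFinset h₂ ∧ c ∉ cl η.toFinset h₂ ∧ Sep (DB ∪ DC) (cl η.toFinset h₂) b c} + (rcMeasureW w q ∅).real {η : BondConfig V | b ∈ cl η.toFinset h₂ ∧ c ∈ cl η.toFinset h₂} * (rcMeasureW w q ({h₁, h₂} : Set V)).real {η : BondConfig V | ¬ (b ∈ cl η.toFinset h₁ ∨ b ∈ cl η.toFinset h₂) ∧ ¬ (c ∈ cl η.toFinset h₁ ∨ c ∈ cl η.toFinset h₂) ∧ Sep (DB ∪ DC) (cl η.toFinset h₁ ∪ cl η.toFinset h₂) b c} ≤ (rcMeasureW w q ({h₁, h₂} : Set V)).real {η : BondConfig V | (b ∈ cl η.toFinset h₁ ∨ b ∈ cl η.toFinset h₂) ∧ ¬ (c ∈ cl η.toFinset h₁ ∨ c ∈ cl η.toFinset h₂)} * (rcMeasureW w q ∅).real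 {η : BondConfig V | b ∉ cl η.toFinset h₂ ∧ c ∈ cl η.toFinset h₂} + (rcMeasureW w q ∅).real {η : BondConfig V | b ∈ cl η.toFinset h₂ ∧ c ∉ cl η.toFinset h₂} * (rcMeasureW w q ({h₁, h₂} : Set V)).real {η : BondConfig V | ¬ (b ∈ cl η.toFinset h₁ ∨ b ∈ cl η.toFinset h₂) ∧ (c ∈ cl η.toFinset h₁ ∨ c ∈ cl η.toFinset h₂)} := by
  obtain ⟨φB, ρB, σB, pXA⟩ := armB_slacks h12 wB hq hR1B hR2B hFB hAB
  obtain ⟨φC, ρC, σC, pYA⟩ := armC_slacks h12 wC hq hR1C hR2C hFC hAC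
  have hZ := rcPartitionFunctionW_pos w hq (∅ : Set V)
  have hZw := rcPartitionFunctionW_pos w hq ({h₁, h₂} : Set V)
  have hK : 0 < q ^ clusterCount (∅ : BondConfig V) ({h₁, h₂} : Set V) := pow_pos hq _
  have hnnB : ∀ (E : Set (BondConfig V)), 0 ≤ ∑ η : BondConfig V, rcWeightW wB q ({h₁, h₂} : Set V) η * ind E η := fun E =>
    Finset.sum_nonneg fun η _ => mul_nonneg (rcWeightW_nonneg wB hq.le _ η) (ind_nonneg E η)
  have hnnC : ∀ (E : Set (BondConfig V)), 0 ≤ ∑ η : BondConfig V, rcWeightW wC q ({h₁, h₂} : Set V) η * ind E η := fun E =>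
    Finset.sum_nonneg fun η _ => mul_nonneg (rcWeightW_nonneg wC hq.le _ η) (ind_nonneg E η)
  have hsep' : ∀ z : V, (∃ e ∈ DB, z ∈ e) → (∃ e ∈ DC, z ∈ e) → (z = h₂ ∨ z = h₁) := fun z h1 h2 => (hsep z h1 h2).symm
  have eT2 := ApexTwoSum.glued_T_sum h12.symm h2b h2c hsep' hbC hcB w wB wC q hw hX hX' hY hY'
  have eUb2 := ApexTwoSum.glued_Ub_sum h12.symm h2b h2c hsep' hbC hcB w wB wC q hw hX hX' hY hY'
  have eUc2 := ApexTwoSum.glued_Uc_sum h12.symm h2b h2c hsep' hbC hcB w wB wC q hw hX hX' hY hY'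
  have eS2 := ApexTwoSum.glued_S_sum h12.symm h2b h2c hbc h1b h1c hsep' hbC hcB w wB wC q hw hX hX' hY hY'
  simp only [Set.pair_comm h₂ h₁, ← cellA_symm b h₁ h₂, ← cellB_symm b h₁ h₂, ← cellC_symm b h₁ h₂, ← cellD_symm b h₁ h₂, ← cellE_symm b h₁ h₂, ← cellA_symm c h₁ h₂, ← cellB_symm c h₁ h₂, ← cellC_symm c h₁ h₂, ← cellD_symm c h₁ h₂, ← cellE_symm c h₁ h₂] at eT2 eUb2 eUc2 eS2
  obtain ⟨wT, wUb, wUc, wS⟩ := wired_cells h1b h1c h2b h2c hbc hsep hbC hcB w wB wC q hw hX hX' hY hY'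
  simp only [rcMeasureW_real_eq_sum_div w hq]
  refine polar_le_div hZw hZ ?_
  refine le_of_mul_le_mul_right (a := q ^ clusterCount (∅ : BondConfig V) ({h₁, h₂} : Set V) * q ^ clusterCount (∅ : BondConfig V) ({h₁, h₂} : Set V)) ?_ (mul_pos hK hK)
  rw [show ∀ x y x' y' K : ℝ, (x * y + x' * y') * (K * K) = (x * K) * (y * K) + (x' * K) * (y' * K) from fun _ _ _ _ _ => by ring,
    wT, eS2, eT2, wS,
    show ∀ x y x' y' K : ℝ, (x * y + x' * y') * (K * K) = (x * K) * (y * K) + (x' * K) * (y' * K) from fun _ _ _ _ _ => by ring,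
    wUb, eUc2, eUb2, wUc, xT_split q wB b, xT'_split q wB b, xT_split q wC c, xT'_split q wC c]
  set XA := (∑ η : BondConfig V, rcWeightW wB q ({h₁, h₂} : Set V) η * ind {η : BondConfig V | b ∈ cl η.toFinset h₁ ∧ h₂ ∈ cl η.toFinset h₁} η) with hXA
  set XB := (∑ η : BondConfig V, rcWeightW wB q ({h₁, h₂} : Set V) η * ind {η : BondConfig V | b ∉ cl η.toFinset h₁ ∧ h₂ ∈ cl η.toFinset h₁} η) with hXB
  set XC := (∑ η : BondConfig V, rcWeightW wB q ({h₁, h₂} : Set V) η * ind {η : BondConfig V | b ∈ cl η.toFinset h₁ ∧ h₂ ∉ cl η.toFinset h₁} η) with hXC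
  set XD := (∑ η : BondConfig V, rcWeightW wB q ({h₁, h₂} : Set V) η * ind {η : BondConfig V | b ∉ cl η.toFinset h₁ ∧ h₂ ∉ cl η.toFinset h₁ ∧ h₂ ∈ cl η.toFinset b} η) with hXD
  set XE := (∑ η : BondConfig V, rcWeightW wB q ({h₁, h₂} : Set V) η * ind {η : BondConfig V | b ∉ cl η.toFinset h₁ ∧ h₂ ∉ cl η.toFinset h₁ ∧ h₂ ∉ cl η.toFinset b} η) with hXE
  set XN := (∑ η : BondConfig V, rcWeightW wB q ({h₁, h₂} : Set V) η * ind {η : BondConfig V | b ∉ cl η.toFinset h₁ ∧ h₂ ∉ cl η.toFinset h₁ ∧ Sep DB (cl η.toFinset h₁) b h₂} η) with hXN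
  set XM := (∑ η : BondConfig V, rcWeightW wB q ({h₁, h₂} : Set V) η * ind {η : BondConfig V | b ∉ cl η.toFinset h₂ ∧ h₁ ∉ cl η.toFinset h₂ ∧ Sep DB (cl η.toFinset h₂) b h₁} η) with hXM
  set YA := (∑ η : BondConfig V, rcWeightW wC q ({h₁, h₂} : Set V) η * ind {η : BondConfig V | c ∈ cl η.toFinset h₁ ∧ h₂ ∈ cl η.toFinset h₁} η) with hYA
  set YB := (∑ η : BondConfig V, rcWeightW wC q ({h₁, h₂} : Set V) η * ind {η : BondConfig V | c ∉ cl η.toFinset h₁ ∧ h₂ ∈ cl η.toFinset h₁} η) with hYB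
  set YC := (∑ η : BondConfig V, rcWeightW wC q ({h₁, h₂} : Set V) η * ind {η : BondConfig V | c ∈ cl η.toFinset h₁ ∧ h₂ ∉ cl η.toFinset h₁} η) with hYC
  set YD := (∑ η : BondConfig V, rcWeightW wC q ({h₁, h₂} : Set V) η * ind {η : BondConfig V | c ∉ cl η.toFinset h₁ ∧ h₂ ∉ cl η.toFinset h₁ ∧ h₂ ∈ cl η.toFinset c} η) with hYD
  set YE := (∑ η : BondConfig V, rcWeightW wC q ({h₁, h₂} : Set V) η * ind {η : BondConfig V | c ∉ cl η.toFinset h₁ ∧ h₂ ∉ cl η.toFinset h₁ ∧ h₂ ∉ cl η.toFinset c} η) with hYE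
  set YN := (∑ η : BondConfig V, rcWeightW wC q ({h₁, h₂} : Set V) η * ind {η : BondConfig V | c ∉ cl η.toFinset h₁ ∧ h₂ ∉ cl η.toFinset h₁ ∧ Sep DC (cl η.toFinset h₁) c h₂} η) with hYN
  set YM := (∑ η : BondConfig V, rcWeightW wC q ({h₁, h₂} : Set V) η * ind {η : BondConfig V | c ∉ cl η.toFinset h₂ ∧ h₁ ∉ cl η.toFinset h₂ ∧ Sep DC (cl η.toFinset h₂) c h₁} η) with hYM
  have cert := ThetaBlocks.W1_cert XA XB (q * XC) (q * XD) (q * XE) (q * XM) YA YB (q * YC) (q * YD) (q * YE) (q * YM) q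
    (hnnB _) (hnnB _) (mul_nonneg hq.le (hnnB _)) (mul_nonneg hq.le (hnnB _)) (hnnC _) (hnnC _)
    (mul_nonneg hq.le (hnnC _)) (mul_nonneg hq.le (hnnC _)) hq.le
    _ _ _ _ rfl rfl rfl rfl φB σB φC σC
    _ _ _ _ _ rfl rfl rfl rfl rfl _ _ _ _ rfl rfl rfl rfl _ _ _ _ rfl rfl rfl rfl
  have hpos : 0 < XA * YA * q ^ 3 := by positivity
  refine le_of_mul_le_mul_left (a := XA * YA * q ^ 3) ?_ hpos
  have key : XA * YA * q ^ 3 * (((XA + XC + XD) * (YB + YE)) * (XB * YA + XE * YA + XB * YD + q * (XC * YD) + q * (XE * YD) + XB * YC) + (XA * YB + XA * YE + XD * YB + q * (XD * YC) + q * (XD * YE) + XC * YB) * ((XB + XE) * (YA + YC + YD))) - XA * YA * q ^ 3 * (((XA + XC + XD) * (YA + YC + YD)) * (XB * YB + XB * YE + XE * YB + q * (XM * YC) + q * (XM * YE) + q * (XC * YM) + q * (XE * YM) - q * (XM * YM)) + (XA * YA + XA * YD + XA * YC + XD * YA + q * (XD * YD) + XC * YA) * ((XB + XE) * (YB + YE)))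 = XA * YA * ((q * YA + (q*YC) + (q*YD)) * ((q * XA + (q*XC) + (q*XD)) + (q * XB + (q*XE))) * (q * XA * (YA + YB) + XA * ((q*YC) + (q*YD) + (q*YE)) + ((q*XC) + (q*XD)) * (YA + YB) + (q*XD) * ((q*YC) + (q*YD) + (q*YE))) + (q * XA + (q*XC) + (q*XD)) * ((q * YA + (q*YC) + (q*YD)) + (q * YB + (q*YE))) * (q * YA * (XA + XB) + YA * ((q*XC) + (q*XD) + (q*XE)) + ((q*YC) + (q*YD)) * (XA + XB) + (q*YD) * ((q*XC) + (q*XD) + (q*XE))) - ((q * XA + (q*XC) + (q*XD)) + (q * XB + (q*XE))) * ((q * YA + (q*YC) + (q*YD)) + (q * YB + (q*YE))) * (q * XA * YA + XA * ((q*YC) + (q*YD)) + ((q*XC) + (q*XD)) * YA + (q*XD) * (q*YD)) - (q * XA + (q*XC) + (q*XD)) * (q * YA + (q*YC) + (q*YD)) * ((q * (XA + XB) * (YA + YB) + (XA + XB) * ((q*YC) + (q*YD) + (q*YE)) + ((q*XC) + (q*XD) + (q*XE)) * (YA + YB) + ((q*XC) + (q*XD) + (q*XE)) * ((q*YC) +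 (q*YD) + (q*YE))) - (((q*XC) + (q*XD) + (q*XE)) - (q*XD) - (q*XM)) * (((q*YC) + (q*YD) + (q*YE)) - (q*YD) - (q*YM)))) := by ring
  linarith [cert, key]

end Rows

end ThetaFar

end Summit.CriticalPhenomena.PercolationContinuityZ3.Theorems
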